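import Summits.QuantumFields.YangMills.Theorems.BalabanUVNodesN11Thm2BSideOfIneq242AtRecord13CoPH

/-!
# DAG node N11 — [III] THEOREM 2's 𝐁-SIDE (2.48) AT THE ₁₃ OBJECTS FROM r11's INDUCTIVE HYPOTHESIS BY NAME: the termwise (2.42) binder `h242` of this seat's files 12 ∕ 13
# READ OFF `Step.LFHyp.boundB` of the tower of record of `(s, t)` (the clause inside def-T's `SLaw₁₃CoPH` ∕ dag-n11-e's `ChainFormAt`), given the (2.41)(ii) membership
# `(ιU, 0) ∈ Ũ^c_j(X)` of the configuration — so `h248` costs only the laws of the witness and a displayed regularity of `U`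

Cell `pub-ymgap`, YM-PLAN Track A (HUMAN RULING D-0062 ∕ D-0149), seat `pub-ymgap-dag-n11-w2` (g2), route `BalabanUVNodes`, key item K1⁷ `StabilityBAtRecordR13SepCoPH` =
stmt-QuantumFields-20542 (helper, count-neutral).  [III] = [Balaban1988Convergent].  Over g0 FILE 12 `…Thm2BSideOfIneq242AtRecord13CoPH` (p595523: `h248_at_record₁₃CoPH_of_ineq242`,
ring anchoring, [II] (1.26) on the torus) and r11 ∕ def-T (`Step.LFHyp`, `Sect2.LawsRT`, `Node00.Sect2.towerOfTerms`: `spaceB j X = Sect2.spaceMS … j (domSites X) Ω`, `B = t.B`).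

WHY THIS FILE.  g0 FILE 12 (docstring, HONEST FRAMING): «(2.42) at the configuration is DISPLAYED (whether `(ιU, 0)` lies in the space `spaceB` where the inductive hypothesis grants
it is the supplier's clause, not read here)».  THIS FILE READS IT: r11's inductive hypothesis `Step.LFHyp T c k` carries `boundB : ∀ j ∈ [1,k], ∀ X φ a, φ ∈ T.spaceB j X →
‖T.B j X φ a‖ ≤ c.B₀·exp(−c.κ·d_j(X))` ((2.42) on the space (2.41)(ii)); at the tower of record of `(s, t)` the space is `Sect2.spaceMS (settingOfRecord₁₃ …) (θ.rzAt p s) θ.τ9.M j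
(domSites X) s.Ω` (`Ũ^c_j(X, α̃₀, α̃₁)` of (2.34)–(2.39)), the terms are `t.B`, the size is `d_j` of the torus catalogue (all `rfl`); `|Re z| ≤ ‖z‖`.  Hence the termwise binder
`h242` of FILES 12 ∕ 13 — and through FILE 12 the (2.48) binder `h248` of FILES 1 ∕ 7 ∕ 11 ∕ 13 and of g2's keyed consumers — follows from the LAWS OF THE WITNESS
(`Sect2.LawsRT (sect2TowerOfRecord … s t) lf k`, exactly what `SLaw₁₃CoPH θ p k` exposes and what dag-n11-e's `ChainFormAt θ p σ k` says of the chain witness) plus the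
displayed regularity «`(ιU, 0) ∈ Ũ^c_j(X)` for the (2.41)(i)-admissible `X`» of the configuration (print p. 263: «sufficiently regular configurations U_k»), with the constants
OF RECORD `B₀ = θ.s2.lf.B₀`, `κ = θ.s2.lf.κ` (`settingOfRecord₁₃_lf`, `lfOfRecord₁₂`).

WHAT THIS FILE PROVES (0 `sorry`, 0 `def`, standard axioms; count-neutral; nothing of Bałaban's asserted — the laws and the membership are HYPOTHESES, displayed).
★ `h242_of_lfHyp_of_mem_spaceMS` (termwise (2.42) on `Re 𝐁^{(j)}(X,(ιU,0),A)` for the (2.41)(i)-admissible `X`, `j = 1,…,k`, from `Step.LFHyp` of the tower of record + membership) ·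
`h242_of_lawsRT_of_mem_spaceMS` (the same from def-T's `Sect2.LawsRT`, the law inside `SLaw₁₃CoPH`) · ★★ `h248_of_lawsRT_of_mem_spaceMS` ((2.48) binder `h248` with
`B₁ = θ.s2.lf.B₀·K₀(4·2^d, 2d)` and volumes `Γ_n ≥ #ring_n(s)`, given `κ₀(4·2^d, 2d) ≤ θ.s2.lf.κ`, `0 ≤ θ.s2.lf.B₀`, `k ≤ m + K`, `1 ≤ M`) · `exists_witness_lawsRT_of_sLaw₁₃CoPH`
(Theorem 1's conclusion `SLaw₁₃CoPH θ p k` exposes a witness family with `LawsRT` at every history) · `h242_of_sLaw₁₃CoPH_witness` (for that witness only the membership is asked).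

HONEST FRAMING ∕ LOCATED.  The membership `(ιU, 0) ∈ spaceMS …` is print's «regular U_k» ((2.34)–(2.39) along Ω_n(s)); reading it off the characteristic functions of (2.18)
(«e.g. for V restricted by the characteristic functions») is the 𝐓-step's small-field analysis ([III] (2.5)–(2.12), [13]), nobody's theorem here.  N11 NOT discharged; K1⁷ NOT
closed; counts unmoved (typed 28∕28 · discharged 5∕27).  One finite four-torus programme at fixed `ε = L^{−K}`; R4 closes only the conditional finite-𝕋⁴ rung `BalabanLadder.UV`;
NOT ℝ⁴, NOT OS, NOT the Yang–Mills mass gap (Clay), which none of this proves.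
Sources: [III] (2.34)–(2.42) p.261, (2.47)–(2.48) pp.263–264, Thm 2 p.263 L14; [Balaban1988RG2Cluster] (1.26) p.8.
-/

noncomputable section

open scoped BigOperators Matrix.Norms.L2Operator

namespace Summit.QuantumFields.YangMills.Theorems.BalabanUVNodesN11Thm2BSideOfLawsRTAtRecord13CoPH

open Literature.MathematicalPhysics.QuantumFieldTheory.Balaban1983to89 Step B14.Eq225Concrete B14Thm2 B12TreeDecay TreeLengthTorus Finset
open T4Continuum Node00
open BalabanUVNodesN11Thm2BSideOfIneq242AtRecord13CoPH (h248_at_record₁₃CoPH_of_ineq242)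

variable {F : T4Family} {N : ℕ} [NeZero N]
variable (θ : Stage13HParams F N) (p : B12.RunParams) {k : ℕ}

/-- **★ TERMWISE (2.42) AT THE RECORD FROM r11's INDUCTIVE HYPOTHESIS BY NAME**: if the tower of record of `(s, t)` satisfies `Step.LFHyp … c k` and the configuration's pair
`(ιU, 0)` lies in the space `Ũ^c_j(X)` of record for every (2.41)(i)-admissible `X` (`j = 1,…,k`), then `|Re 𝐁^{(j)}(X,(ιU,0),A)| ≤ c.B₀·exp(−c.κ·d_j(X))` there — the binder `h242`
of g0 FILES 12 ∕ 13 with `B₀ = c.B₀`, `κ_B = c.κ`. [cite: Balaban1988Convergent, (2.41)–(2.42) p.261] -/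
theorem h242_of_lfHyp_of_mem_spaceMS (s : SeqOfRecord F θ.ν θ.τ9.M (gOfRecord₁₃ F N θ.toStage13Params p) p.K k)
    (t : Sect2.TermValues (F.P p.K) (MatA N) (FluctV N) θ.τ9.M) (a : Tk.SFluct (F.P p.K) (FluctV N)) (U : GaugeField (F.P p.K) 0 (SU N)) {c : LFConsts}
    (hlaw : LFHyp (sect2TowerOfRecord F N (FluctV N) p.K (settingOfRecord₁₃ F N θ.toStage13Params p) (θ.rzAt p s) s t) c k)
    (hU : ∀ j, 1 ≤ j → j ≤ k → ∀ X, Sect2.admB (F.P p.K) θ.ν θ.τ9.M (gOfRecord₁₃ F N θ.toStage13Params p) s.Ω s.Λ j (Sect2.domSites (F.P p.K) θ.τ9.M j X) = true →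
      Sect2.ofBackgroundC (ιSU N) U ∈ Sect2.spaceMS (settingOfRecord₁₃ F N θ.toStage13Params p) (θ.rzAt p s) θ.τ9.M j (Sect2.domSites (F.P p.K) θ.τ9.M j X) s.Ω) :
    ∀ j, 1 ≤ j → j ≤ k → ∀ X, Sect2.admB (F.P p.K) θ.ν θ.τ9.M (gOfRecord₁₃ F N θ.toStage13Params p) s.Ω s.Λ j (Sect2.domSites (F.P p.K) θ.τ9.M j X) = true →
      |(t.B j X (Sect2.ofBackgroundC (ιSU N) U) a).re| ≤ c.B₀ * Real.exp (-c.κ * (Sect2.domSys (F.P p.K) θ.τ9.M j).dj X) := by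
  intro j hj hjk X hX
  have h := hlaw.boundB j hj hjk X (Sect2.ofBackgroundC (ιSU N) U) a (hU j hj hjk X hX)
  exact (Complex.abs_re_le_norm _).trans h

/-- **The same from def-T's `Sect2.LawsRT`** (the law `SLaw₁₃CoPH θ p k` imposes on its witness at every history, and dag-n11-e's `ChainFormAt θ p σ k` on the chain witness).
[cite: Balaban1988Convergent, (2.41)–(2.42) p.261, Thm 1 p.262] -/
theorem h242_of_lawsRT_of_mem_spaceMS (s : SeqOfRecord F θ.ν θ.τ9.M (gOfRecord₁₃ F N θ.toStage13Params p) p.K k)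
    (t : Sect2.TermValues (F.P p.K) (MatA N) (FluctV N) θ.τ9.M) (a : Tk.SFluct (F.P p.K) (FluctV N)) (U : GaugeField (F.P p.K) 0 (SU N)) {c : LFConsts}
    (hlaw : Sect2.LawsRT (sect2TowerOfRecord F N (FluctV N) p.K (settingOfRecord₁₃ F N θ.toStage13Params p) (θ.rzAt p s) s t) c k)
    (hU : ∀ j, 1 ≤ j → j ≤ k → ∀ X, Sect2.admB (F.P p.K) θ.ν θ.τ9.M (gOfRecord₁₃ F N θ.toStage13Params p) s.Ω s.Λ j (Sect2.domSites (F.P p.K) θ.τ9.M j X) = true →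
      Sect2.ofBackgroundC (ιSU N) U ∈ Sect2.spaceMS (settingOfRecord₁₃ F N θ.toStage13Params p) (θ.rzAt p s) θ.τ9.M j (Sect2.domSites (F.P p.K) θ.τ9.M j X) s.Ω) :
    ∀ j, 1 ≤ j → j ≤ k → ∀ X, Sect2.admB (F.P p.K) θ.ν θ.τ9.M (gOfRecord₁₃ F N θ.toStage13Params p) s.Ω s.Λ j (Sect2.domSites (F.P p.K) θ.τ9.M j X) = true →
      |(t.B j X (Sect2.ofBackgroundC (ιSU N) U) a).re| ≤ c.B₀ * Real.exp (-c.κ * (Sect2.domSys (F.P p.K) θ.τ9.M j).dj X) :=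
  h242_of_lfHyp_of_mem_spaceMS θ p s t a U hlaw.1 hU

open Classical in
/-- **★★ FILE 1's (2.48) BINDER `h248` FROM THE LAWS OF THE WITNESS + THE (2.41)(ii) MEMBERSHIP OF THE CONFIGURATION**, constants OF RECORD: with the witness's laws
`Sect2.LawsRT (tower of record of (s, t)) (settingOfRecord₁₃ …).lf k`, `(ιU, 0) ∈ Ũ^c_j(X)` for the (2.41)(i)-admissible `X`, `κ₀(4·2^d, 2d) ≤ θ.s2.lf.κ`, `0 ≤ θ.s2.lf.B₀`,
`k ≤ m + K`, `1 ≤ M`, and volumes dominating the anchor rings `#ring_n(s) ≤ Γ_n`: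
`|B240 (tower of record) (admB of record) a k U| ≤ 2·(θ.s2.lf.B₀·K₀(4·2^d, 2d))·Σ_{n=1}^{k} Γ_n` (g0 FILE 12's `h248_at_record₁₃CoPH_of_ineq242` ∘ `h242_of_lawsRT_of_mem_spaceMS`).
[cite: Balaban1988Convergent, (2.42) p.261, (2.47)–(2.48) pp.263–264; Balaban1988RG2Cluster, (1.26) p.8] -/
theorem h248_of_lawsRT_of_mem_spaceMS (s : SeqOfRecord F θ.ν θ.τ9.M (gOfRecord₁₃ F N θ.toStage13Params p) p.K k)
    (t : Sect2.TermValues (F.P p.K) (MatA N) (FluctV N) θ.τ9.M) (a : Tk.SFluct (F.P p.K) (FluctV N)) (U : GaugeField (F.P p.K) 0 (SU N))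
    (hk : k ≤ (F.P p.K).m + (F.P p.K).K) (hM : 1 ≤ θ.τ9.M)
    (hκ : kappa₀ (4 * 2 ^ (F.P p.K).d) (2 * (F.P p.K).d) ≤ θ.s2.lf.κ) (hB₀ : 0 ≤ θ.s2.lf.B₀)
    (hlaw : Sect2.LawsRT (sect2TowerOfRecord F N (FluctV N) p.K (settingOfRecord₁₃ F N θ.toStage13Params p) (θ.rzAt p s) s t)
      (settingOfRecord₁₃ F N θ.toStage13Params p).lf k)
    (hU : ∀ j, 1 ≤ j → j ≤ k → ∀ X, Sect2.admB (F.P p.K) θ.ν θ.τ9.M (gOfRecord₁₃ F N θ.toStage13Params p) s.Ω s.Λ j (Sect2.domSites (F.P p.K) θ.τ9.M j X) = true →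
      Sect2.ofBackgroundC (ιSU N) U ∈ Sect2.spaceMS (settingOfRecord₁₃ F N θ.toStage13Params p) (θ.rzAt p s) θ.τ9.M j (Sect2.domSites (F.P p.K) θ.τ9.M j X) s.Ω)
    (Γ : ℕ → ℝ)
    (hΓ : ∀ n, 1 ≤ n → n ≤ k →
      ((univ.filter fun c : TPt (F.P p.K).d (Sect2.domCount (F.P p.K) θ.τ9.M n) =>
          (Sect2.domSites (F.P p.K) θ.τ9.M n (Sect2.cubeDom (F.P p.K) θ.τ9.M n c) ∩
              Sect2.enlT (F.P p.K) (Sect2.zSide (F.P p.K) θ.ν θ.τ9.M (gOfRecord₁₃ F N θ.toStage13Params p) n) 1 (s.Λ n)ᶜ).Nonempty ∧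
            ∃ c', (c' = c ∨ TAdj c' c) ∧ (Sect2.domSites (F.P p.K) θ.τ9.M n (Sect2.cubeDom (F.P p.K) θ.τ9.M n c') ∩ s.Ω n).Nonempty).card : ℝ) ≤ Γ n) :
    |B240 (sect2TowerOfRecord F N (FluctV N) p.K (settingOfRecord₁₃ F N θ.toStage13Params p) (θ.rzAt p s) s t)
        (fun j X => Sect2.admB (F.P p.K) θ.ν θ.τ9.M (gOfRecord₁₃ F N θ.toStage13Params p) s.Ω s.Λ j (Sect2.domSites (F.P p.K) θ.τ9.M j X)) a k U| ≤
      2 * (θ.s2.lf.B₀ * K₀ (4 * 2 ^ (F.P p.K).d) (2 * (F.P p.K).d)) * ∑ n ∈ Icc 1 k, Γ n := by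
  -- the constants of record: `(settingOfRecord₁₃ …).lf = lfOfRecord₁₂ … = {θ.s2.lf with γ := θ.γ}` (`settingOfRecord₁₃_lf`), so `.B₀ ∕ .κ` are `θ.s2.lf.B₀ ∕ θ.s2.lf.κ` by `rfl`
  have eB : (settingOfRecord₁₃ F N θ.toStage13Params p).lf.B₀ = θ.s2.lf.B₀ := rfl
  have eκ : (settingOfRecord₁₃ F N θ.toStage13Params p).lf.κ = θ.s2.lf.κ := rfl
  have h242 := h242_of_lawsRT_of_mem_spaceMS θ p s t a U hlaw hU
  rw [eB, eκ] at h242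
  exact h248_at_record₁₃CoPH_of_ineq242 θ p s t a U hk hM hκ hB₀ h242 Γ hΓ

/-- **THE WITNESS `SLaw₁₃CoPH θ p k` EXPOSES HAS THE LAWS**: Theorem 1's conclusion at level `k` (def-T's `SLaw₁₃CoPH`, `sLaw₁₃CoPH_iff`) gives a term-value family `t` with
`Sect2.LawsRT (tower of record of (s, t s)) (settingOfRecord₁₃ …).lf k` AT EVERY HISTORY `s` — so for that witness the termwise (2.42) binder `h242` costs only the (2.41)(ii)
membership of the configuration. [cite: Balaban1988Convergent, Thm 1 p.262, (2.41)–(2.42) p.261] -/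
theorem exists_witness_lawsRT_of_sLaw₁₃CoPH (h : SLaw₁₃CoPH F N θ p k) :
    ∃ t : SeqOfRecord F θ.ν θ.τ9.M (gOfRecord₁₃ F N θ.toStage13Params p) p.K k → Sect2.TermValues (F.P p.K) (MatA N) (FluctV N) θ.τ9.M,
      ∀ s, Sect2.LawsRT (sect2TowerOfRecord F N (FluctV N) p.K (settingOfRecord₁₃ F N θ.toStage13Params p) (θ.rzAt p s) s (t s))
        (settingOfRecord₁₃ F N θ.toStage13Params p).lf k := by
  obtain ⟨t, _, hform⟩ := (sLaw₁₃CoPH_iff F N θ p k).mp h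
  exact ⟨t, fun s => (hform.2 s).1⟩

/-- **`h242` FOR THE WITNESS THEOREM 1 EXPOSES, from the membership alone** (constants of record `θ.s2.lf.B₀`, `θ.s2.lf.κ`).
[cite: Balaban1988Convergent, Thm 1 p.262, (2.41)–(2.42) p.261] -/
theorem h242_of_sLaw₁₃CoPH_witness (h : SLaw₁₃CoPH F N θ p k) :
    ∃ t : SeqOfRecord F θ.ν θ.τ9.M (gOfRecord₁₃ F N θ.toStage13Params p) p.K k → Sect2.TermValues (F.P p.K) (MatA N) (FluctV N) θ.τ9.M,
      (∀ s, Sect2.LawsRT (sect2TowerOfRecord F N (FluctV N) p.K (settingOfRecord₁₃ F N θ.toStage13Params p) (θ.rzAt p s) s (t s))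
        (settingOfRecord₁₃ F N θ.toStage13Params p).lf k) ∧
      ∀ (s : SeqOfRecord F θ.ν θ.τ9.M (gOfRecord₁₃ F N θ.toStage13Params p) p.K k) (a : Tk.SFluct (F.P p.K) (FluctV N)) (U : GaugeField (F.P p.K) 0 (SU N)),
        (∀ j, 1 ≤ j → j ≤ k → ∀ X, Sect2.admB (F.P p.K) θ.ν θ.τ9.M (gOfRecord₁₃ F N θ.toStage13Params p) s.Ω s.Λ j (Sect2.domSites (F.P p.K) θ.τ9.M j X) = true →
          Sect2.ofBackgroundC (ιSU N) U ∈ Sect2.spaceMS (settingOfRecord₁₃ F N θ.toStage13Params p) (θ.rzAt p s) θ.τ9.M j (Sect2.domSites (F.P p.K) θ.τ9.M j X) s.Ω) →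
        ∀ j, 1 ≤ j → j ≤ k → ∀ X, Sect2.admB (F.P p.K) θ.ν θ.τ9.M (gOfRecord₁₃ F N θ.toStage13Params p) s.Ω s.Λ j (Sect2.domSites (F.P p.K) θ.τ9.M j X) = true →
          |((t s).B j X (Sect2.ofBackgroundC (ιSU N) U) a).re| ≤ θ.s2.lf.B₀ * Real.exp (-θ.s2.lf.κ * (Sect2.domSys (F.P p.K) θ.τ9.M j).dj X) := by
  obtain ⟨t, ht⟩ := exists_witness_lawsRT_of_sLaw₁₃CoPH θ p h
  refine ⟨t, ht, fun s a U hU => ?_⟩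
  have eB : (settingOfRecord₁₃ F N θ.toStage13Params p).lf.B₀ = θ.s2.lf.B₀ := rfl
  have eκ : (settingOfRecord₁₃ F N θ.toStage13Params p).lf.κ = θ.s2.lf.κ := rfl
  have h242 := h242_of_lawsRT_of_mem_spaceMS θ p s (t s) a U (ht s) hU
  rw [eB, eκ] at h242
  exact h242

end Summit.QuantumFields.YangMills.Theorems.BalabanUVNodesN11Thm2BSideOfLawsRTAtRecord13CoPH

end
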